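import Literature.Computability.Complexity.SparseSetsUpwardSeparation
import Literature.Computability.Complexity.NPEqUnionNTIME
import Literature.Computability.Complexity.KannanLanguage
import Literature.Computability.MetaComplexity.AvgCaseTallyNE
import HarnessLib

/-!
# Book 1974, Theorem 1, (i) ⇔ (ii): `NE ⊆ E` iff every tally `NP` language is in `P` — proof

Discharge of the named fact `Literature.Computability.Complexity.book1974_thm1`
(`SparseSetsUpwardSeparation.lean`): R. V. Book, *Tally languages and complexity classes*,
Information and Control 26 (1974) 186–193, Theorem 1 (p. 189), equivalence of

* (i) `NE ⊆ E` ("every language accepted by a nondeterministic Turing machine which operates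
  within time bound `2^{cn}` … is also accepted by a deterministic Turing machine which operates
  within time bound `2^{dn}`"), and
* (ii) every tally language in `NP` is in `P`,

over the tree's classes `E`, `NE`, `Classes.P`, `Nondeterministic.NP` and the tree's tally notion
`Literature.Barriers.PneNP.IsTally` (`T ⊆ 0*`).

## The printed proof and its formalization

Book (p. 189): "The equivalence of (i) and (ii) follows from Lemmas 2 and 3", where, for
`TALLY(L) = {1^{n(w)} | w ∈ L}` (`n(w)` the number with `k`-adic notation `w`, `|w| ∼ log n(w)`):

* **Lemma 2** (p. 187): if `L` is accepted in (non)deterministic time `g`, `g(n) ≥ 2ⁿ`, then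
  `TALLY(L)` is accepted in (non)deterministic time `c₁ g(c₂ log n)` ("given `1ᵐ`, write `w` with
  `n(w) = m` on a storage tape, then imitate `M₁` on `w`");
* **Lemma 3** (p. 188): if the tally language `L₁ = TALLY(L₂)` is accepted in (non)deterministic
  time `g(n) ≥ n`, then `L₂` is accepted in (non)deterministic time `c₁ g(2^{c₂ n})` (pad, then run).

(i) ⇒ (ii): for a tally `L₁ ∈ NP` the language `L₂` with `TALLY(L₂) = L₁` is in `NE` (Lemma 3,
nondeterministic), hence in `E` by (i), hence `L₁ = TALLY(L₂) ∈ P` (Lemma 2, deterministic).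
(ii) ⇒ (i): for `L ∈ NE`, `TALLY(L) ∈ NP` (Lemma 2, nondeterministic) is tally, hence in `P` by
(ii), hence `L ∈ E` (Lemma 3, deterministic).

The tree already holds the tally code over the letter `1` (`Literature/Computability/MetaComplexity/
AvgCaseTallyNE.lean`, namespace `AvgTallyNE`): `tnum x = ⟦x1⟧₂` (Book's `n(w)`, dyadic),
the polynomial-time decoder `tallyDecodeFn` (depends on the LENGTH of its argument only),
`tallyTruncLang L = {w | tallyDecodeFn w ∈ L}`, and Lemma 2 (nondeterministic) in the form
`tallyTruncLang_mem_NP : L ∈ NTIME(2^{an}) → tallyTruncLang L ∈ NP`; and the exponential-time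
bookkeeping of `ExpTimeMaps.lean` (`FE`, `preimage_mem_E` = Lemma 3, deterministic, for a pad in
`FE`). Since the tree's tally sets are over the letter `0` (`IsTally`), this file uses the pad
`pad0Fn x = 0^{tnum x}` (in `FE`) and the format language `0* = {w | zerosFn w = w} ∈ P` (the zero-word
brick `Kannan.zerosFn` of `KannanLanguage.lean`), and adds
the two missing lemma instances in the tree's machine model (Mathlib `FinTM2`, verifier-form
`NTIME` of `Nondeterministic.lean`):

* `preimage_NP_mem_NE` (Lemma 3, nondeterministic, functional form): `g ∈ FE`, `L ∈ NP` ⟹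
  `g ⁻¹' L ∈ NE` — the verifier is the truncating wrapper `truncMapAux` (`TruncMapMachine.lean`)
  of the clock `x ↦ ⟨g x, 1^{p(|g x|)+1}⟩` followed by a decider of `LenLe p ⊓ L'`, exactly the
  pattern of `NP_subset_iUnion_NTIME` (`NPEqUnionNTIME.lean`) with the `2^{O(n)}`-time map `g` in
  front of the clock;
* `preimage_E_mem_P` (Lemma 2, deterministic, functional form): `f ∈ FP` with logarithmically
  short values (`2^{|f w|} ≤ 2|w| + 2`, as `tallyDecodeFn`) and `L ∈ E` ⟹ `f ⁻¹' L ∈ P` (compute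
  `f`, then run the `2^{cn}`-time decider on the short word: `2^{c |f w|} ≤ (2|w|+2)^c`).

The empty word (Book's tally words `1^{n(w)}` have `n(w) ≥ 1`; `tnum x ≥ 1`) is patched by the
closure of `P` under `⊓`, `⊔`, complement and `{ε} ∈ P`. Preimages and `{ε}` are handled through
the `Language`-typed wrappers `pre f L = {x | f x ∈ L}` and `nilLang` (rewriting under the `def`
`Language Bool = Set (List Bool)`).

## References

* R. V. Book, *Tally languages and complexity classes*, Information and Control 26 (1974)
  186–193: Lemma 2 (p. 187), Lemma 3 (p. 188), Theorem 1 (p. 189) (held: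
  `paper:doi-10-1016-s0019-9958-74-90473-2`, p0002–p0004). [Book1974]
* S. Arora, B. Barak, *Computational Complexity: A Modern Approach*, CUP 2009, §2.6.2
  (padding; `EXP ≠ NEXP ⟹ P ≠ NP`, Thm. 2.22), Thm. 2.6 (`NP = ⋃ NTIME(nᶜ)`). [AroraBarakCC2009]

## Design notes

No definition of mathematical content and no named fact is introduced (D-0026): `zerosFmt`,
`nilLang`, `pre`, `pad0Fn` are proof devices of this file (namespace `Book1974`); the membership
lemmas `mem_*` are the file's private rewriting kit.
-/

noncomputable section

namespace Literature.Computability.Complexity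

open _root_.Computability Turing Polynomial Brick Plumb PairFstTM Nondeterministic
open Literature.Barriers.PneNP (IsTally)
open Literature.Computability.MetaComplexity.AvgTallyNE
open Kannan (zerosFn zerosFn_apply zerosFn_mem_FP)

namespace Book1974

/-! ### The letter `0`: the format language `0*` (zero words `Kannan.zerosFn w = 0^{|w|}`, an `FP` brick) -/

/-- The **format language of the tally words over `0`**: `0* = {w | zerosFn w = w}`. [cite: Book1974, p. 187 (tally languages)] -/
def zerosFmt : Language Bool := {w | zerosFn w = w}

/-- Membership in `0*`: every letter is `0`. [folklore] -/
theorem mem_zerosFmt_iff (w : List Bool) : w ∈ zerosFmt ↔ ∀ b ∈ w, b = false := by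
  change zerosFn w = w ↔ _
  rw [zerosFn_apply, eq_comm, List.eq_replicate_iff]
  exact ⟨fun h => h.2, fun h => ⟨rfl, h⟩⟩

/-- `0ⁿ ∈ 0*`. [folklore] -/
theorem replicate_false_mem_zerosFmt (n : ℕ) : List.replicate n false ∈ zerosFmt :=
  (mem_zerosFmt_iff _).2 fun _ hb => List.eq_of_mem_replicate hb

/-- A word of a tally language is the zero word of its length. [folklore] -/
theorem eq_replicate_of_isTally {L : Language Bool} (hL : IsTally L) {w : List Bool} (hw : w ∈ L) :
    w = List.replicate w.length false :=
  List.eq_replicate_iff.2 ⟨rfl, hL w hw⟩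

/-- **`0* ∈ P`** (equality test of the two `FP` maps `zerosFn` and `id`). [folklore] -/
theorem zerosFmt_mem_P : zerosFmt ∈ Classes.P := by
  show ({w | zerosFn w = w} : Language Bool) ∈ Classes.P
  have h := setOf_apply_eq_apply_mem_P zerosFn_mem_FP OracleCompose.id_mem_FP
  simpa only [id_eq] using h

/-! ### Membership bookkeeping for languages (all definitional)

`Language Bool` is a `def` over `Set (List Bool)`, so set-builder terms and `Set.preimage` in
`Language` positions are only type-correct up to unfolding; the rewriting below therefore goes
through the `Language`-typed wrappers `pre f L` (preimage) and `nilLang = {ε}`. -/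

/-- The preimage language `pre f L = {x | f x ∈ L}` (`= f ⁻¹' L` as a `Language`). [folklore] -/
def pre (f : List Bool → List Bool) (L : Language Bool) : Language Bool := {x | f x ∈ L}

/-- Membership in a preimage language. [folklore] -/
private theorem mem_pre {f : List Bool → List Bool} {L : Language Bool} {x : List Bool} :
    x ∈ pre f L ↔ f x ∈ L := Iff.rfl

/-- `pre f L` is the set-theoretic preimage. [folklore] -/
theorem pre_eq_preimage (f : List Bool → List Bool) (L : Language Bool) :
    pre f L = (f ⁻¹' L : Language Bool) := rfl

/-- The language `{ε}`. [folklore] -/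
def nilLang : Language Bool := {w | w = []}

/-- Membership in `{ε}`. [folklore] -/
private theorem mem_nilLang {x : List Bool} : x ∈ nilLang ↔ x = [] := Iff.rfl

/-- Membership in a meet of languages. [folklore] -/
private theorem mem_inf_lang {A B : Language Bool} {x : List Bool} : x ∈ A ⊓ B ↔ x ∈ A ∧ x ∈ B := Iff.rfl

/-- Membership in a join of languages. [folklore] -/
private theorem mem_sup_lang {A B : Language Bool} {x : List Bool} : x ∈ A ⊔ B ↔ x ∈ A ∨ x ∈ B := Iff.rfl

/-- Membership in the complement of a language. [folklore] -/
private theorem mem_compl_lang {A : Language Bool} {x : List Bool} : x ∈ Aᶜ ↔ x ∉ A := Iff.rfl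

/-- `{ε} ∈ P` (equality test of `id` and the constant `ε`). [folklore] -/
theorem nilLang_mem_P : nilLang ∈ Classes.P := by
  show ({w | w = []} : Language Bool) ∈ Classes.P
  have h := setOf_apply_eq_apply_mem_P OracleCompose.id_mem_FP (const_mem_FP [])
  simpa only [id_eq] using h

/-! ### The tally code over `0`: `pad0Fn x = 0^{tnum x}`, computable in time `2^{O(|x|)}` -/

/-- **The tally pad over `0`**, `x ↦ 0^{tnum x}` (Book's `w ↦ 1^{n(w)}` with the letter `0`):
append the leading bit, copy, expand the first copy to the ruler `expPad 1`, convert the numeral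
`x1` to unary against that ruler (as in `AvgTallyNE.tallyPadFn`), then overwrite with zeros.
[cite: Book1974, p. 187 (TALLY(L))] -/
def pad0Fn : List Bool → List Bool :=
  zerosFn ∘ binToUnaryFn ∘ mapFstFn (expPad 1) ∘ copyFn ∘ fun x => x ++ [true]

/-- Value of the pad: `pad0Fn x = 0^{tnum x}`. [folklore] -/
theorem pad0Fn_apply (x : List Bool) : pad0Fn x = List.replicate (tnum x) false := by
  have hmin : min (bitsToNat (x ++ [true])) (expPad 1 (x ++ [true])).length = tnum x := by
    rw [length_expPad, pow_one, List.length_append, List.length_singleton]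
    exact min_eq_left (by have := tnum_lt x; unfold tnum at *; omega)
  simp only [pad0Fn, Function.comp_apply, copyFn_apply, mapFstFn_boolPair, binToUnaryFn_boolPair,
    hmin, zerosFn_apply, List.length_replicate]

/-- Length of the pad: `|pad0Fn x| = tnum x`. [folklore] -/
theorem length_pad0Fn (x : List Bool) : (pad0Fn x).length = tnum x := by
  rw [pad0Fn_apply, List.length_replicate]

/-- **The pad is computable in time `2^{O(n)}`**: `pad0Fn ∈ FE`. [cite: Book1974, Lemma 3 (p. 188)] -/
theorem pad0Fn_mem_FE : pad0Fn ∈ FE := by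
  refine comp_mem_FE zerosFn_mem_FP (comp_mem_FE binToUnaryFn_mem_FP ?_)
  refine comp_mem_FE_of_linear (mapFstFn_mem_FE expPad_one_mem_FE)
    (comp_mem_FP copyFn_mem_FP (append_mem_FP OracleCompose.id_mem_FP (const_mem_FP [true]))) 5
    fun w => ?_
  simp only [Function.comp_apply, copyFn_apply, length_boolPair, List.length_append,
    List.length_singleton]
  omega

/-! ### The decoder inverts the pad (both ways round) -/

/-- The decoder only sees the length: `tallyDecodeFn 0ⁿ = tallyDecodeFn 1ⁿ`. [folklore] -/
theorem tallyDecodeFn_replicate (n : ℕ) (b : Bool) :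
    tallyDecodeFn (List.replicate n b) = tallyDecodeFn (unaryEncodeNat n) := by
  rw [tallyDecodeFn_apply, tallyDecodeFn_apply, List.length_replicate, unaryEncodeNat_eq_replicate,
    List.length_replicate]

/-- **The decoder inverts the pad**: `tallyDecodeFn (pad0Fn x) = x`. [folklore] -/
theorem tallyDecodeFn_pad0Fn (x : List Bool) : tallyDecodeFn (pad0Fn x) = x := by
  rw [pad0Fn_apply, tallyDecodeFn_replicate, tallyDecodeFn_unaryEncodeNat_tnum]

/-- **The pad inverts the decoder on nonempty words**: `tnum (tallyDecodeFn w) = |w|` for `w ≠ ε`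
(the code `x ↦ tnum x` is onto the positive integers: `encodeNat N` ends in `1` for `N ≥ 1`).
[folklore] -/
theorem tnum_tallyDecodeFn {w : List Bool} (hw : w ≠ []) : tnum (tallyDecodeFn w) = w.length := by
  rw [tallyDecodeFn_apply]
  have hN : 0 < w.length := List.length_pos_of_ne_nil hw
  obtain ⟨l, hl⟩ : ∃ l : List Bool, encodeNat w.length = l ++ [true] := by
    rcases isCanonicalNum_encodeNat w.length with h | h
    · exfalso
      have h1 := bitsToNat_encodeNat w.length
      rw [h, bitsToNat_nil] at h1
      omega
    · exact ⟨_, (List.getLast?_eq_some_iff.1 h).choose_spec⟩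
  rw [hl, List.length_append, List.length_singleton, Nat.add_sub_cancel, List.take_left', tnum,
    ← hl, bitsToNat_encodeNat]
  rfl

/-- Hence, on a nonempty word `w`, `pad0Fn (tallyDecodeFn w) = 0^{|w|}`. [folklore] -/
theorem pad0Fn_tallyDecodeFn {w : List Bool} (hw : w ≠ []) :
    pad0Fn (tallyDecodeFn w) = List.replicate w.length false := by
  rw [pad0Fn_apply, tnum_tallyDecodeFn hw]

/-! ### Lemma 3 (nondeterministic): preimages of `NP` languages under `2^{O(n)}`-time maps are in `NE` -/

/-- **Book 1974, Lemma 3 (nondeterministic case), functional form.** If `g ∈ FE` (computable in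
time `2^{O(n)}`) and `L ∈ NP`, then `g ⁻¹' L ∈ NE`. For `L` presented by `L' ∈ P` and the witness
polynomial `p`, the verifier of `g ⁻¹' L` on `⟨x, y⟩` is the truncating wrapper `truncMapAux`
for the clock `x ↦ ⟨g x, 1^{p(|g x|)+1}⟩` (the `FE` machine of `g` followed by the polynomial
clock of `exists_machine_pair_ones`) — output `⟨g x, y ↾ (p(|g x|)+1)⟩` within
`2^{O(|x|)} + |y| / 2` steps — followed by a polynomial-time decider of `LenLe p ⊓ L'` on a word
of length `2^{O(|x|)}`; all bounds are `≤ K₀ 2^{c₀|x|} + K₀ + |y| / 2`, and the admissible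
witnesses of `g x` are unchanged (Book: "imitate `M₁`'s computation on `w`", with the
certificate of the tree's verifier form of `NTIME` cut at the admissible length, as in
`NP_subset_iUnion_NTIME`). [cite: Book1974, Lemma 3 (p. 188)] -/
theorem preimage_NP_mem_NE {g : List Bool → List Bool} (hg : g ∈ FE) {L : Language Bool}
    (hL : L ∈ NP) : pre g L ∈ NE := by
  obtain ⟨L', hL'P, p, hLw⟩ := hL
  -- a decider of `LenLe p ⊓ L'`
  have hL'' : LenLe p ⊓ L' ∈ Classes.P := inter_mem_P (LenLe_mem_P p) hL'P
  simp only [Classes.P, Set.mem_iUnion] at hL''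
  obtain ⟨k, a, hdec⟩ := hL''
  obtain ⟨M, hM⟩ := (hdec : TimeDecidable id (LenLe p ⊓ L') fun n => a * n ^ k + a)
  -- the machine of `g` and the length of its outputs
  obtain ⟨s, hs, -, hsl⟩ := exists_length_le_of_mem_FE hg
  obtain ⟨c, K, G, hG⟩ := mem_FE_iff.1 hg
  -- the polynomial clock behind `g`
  obtain ⟨q, N, hN⟩ := exists_machine_pair_ones p
  -- the dominating exponential
  have hB : IsExpBounded fun n => a * (2 * s n + 3 + p.eval (s n)) ^ k + a +
      (q.eval (s n) + (K * 2 ^ (c * n) + K) + 3 * s n + 2 * (p.eval (s n) + 1) + 2 * n + 11) :=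
    ((((((hs.const_mul 2).add (IsExpBounded.const 3)).add (hs.poly_comp p)).pow k).const_mul a).add
      (IsExpBounded.const a)).add
    ((((((hs.poly_comp q).add (IsExpBounded.shape c K)).add (hs.const_mul 3)).add
      (((hs.poly_comp p).add (IsExpBounded.const 1)).const_mul 2)).add
        (IsExpBounded.id.const_mul 2)).add (IsExpBounded.const 11))
  obtain ⟨c₀, K₀, hK₀⟩ := hB.exists_le_mul_add
  let V : TM2ComputableAux Bool Bool := (truncMapAux (G.comp N)).comp M
  refine Set.mem_iUnion.2 ⟨c₀, 2 * K₀ + 2,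
    fun x y => (LenLe p ⊓ L').boolIndicator (boolPair (g x) (y.take (p.eval (g x).length + 1))), V,
    fun x y hy => ?_, fun x => ?_⟩
  · -- running time
    have hclock : (G.comp N).OutputsWithin x (boolPair (g x) (ones (p.eval (g x).length + 1)))
        (q.eval (g x).length + (K * 2 ^ (c * x.length) + K)) :=
      TM2ComputableAux.comp_outputsWithin G N (hG x) (hN (g x))
    have h₁ := outputsWithin_truncMapAux_boolPair (G.comp N) (y := y) hclock
    simp only [List.length_replicate] at h₁
    set y' := y.take (p.eval (g x).length + 1) with hy'
    have hlen' : y'.length ≤ p.eval (g x).length + 1 := List.length_take_le _ _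
    have h₂ : M.OutputsWithin (boolPair (g x) y') (encodeBool ((LenLe p ⊓ L').boolIndicator
        (boolPair (g x) y'))) (a * (2 * (g x).length + 3 + p.eval (g x).length) ^ k + a) := by
      refine (hM (boolPair (g x) y')).mono ?_
      simp only [id, length_boolPair]
      have : 2 * (g x).length + 2 + y'.length ≤ 2 * (g x).length + 3 + p.eval (g x).length := by omega
      exact Nat.add_le_add_right (Nat.mul_le_mul_left a (Nat.pow_le_pow_left this k)) a
    have h := TM2ComputableAux.comp_outputsWithin _ _ h₁ h₂
    refine h.mono ?_
    -- the estimates, all `2^{O(|x|)}` but `|y| / 2`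
    have hgx : (g x).length ≤ s x.length := hsl x
    have hq : q.eval (g x).length ≤ q.eval (s x.length) := TM2Iter.eval_mono q hgx
    have hp : p.eval (g x).length ≤ p.eval (s x.length) := TM2Iter.eval_mono p hgx
    have hpow : a * (2 * (g x).length + 3 + p.eval (g x).length) ^ k ≤
        a * (2 * s x.length + 3 + p.eval (s x.length)) ^ k :=
      Nat.mul_le_mul_left a (Nat.pow_le_pow_left (by omega) k)
    have hBx := hK₀ x.length
    have hy2 : 2 * (y.length / 2) ≤ (2 * K₀ + 2) * 2 ^ (c₀ * x.length) + (2 * K₀ + 2) :=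
      (Nat.mul_div_le y.length 2).trans hy
    have hP0 := Nat.zero_le (2 ^ (c₀ * x.length))
    show _ ≤ (2 * K₀ + 2) * 2 ^ (c₀ * x.length) + (2 * K₀ + 2)
    linarith [hpow, hq, hp, hgx, hBx, hy2, hP0]
  · -- correctness: the admissible witnesses of `g x` are the same
    have hind : ∀ w : List Bool, (LenLe p ⊓ L').boolIndicator w = true ↔ w ∈ LenLe p ∧ w ∈ L' :=
      fun w => (Set.mem_iff_boolIndicator ((LenLe p ⊓ L' : Language Bool) : Set (List Bool)) w).symm
    rw [mem_pre, hLw (g x)]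
    constructor
    · rintro ⟨y₀, hy₀, hmem⟩
      refine ⟨y₀, ?_, ?_⟩
      · have hBx := hK₀ x.length
        have hp : p.eval (g x).length ≤ p.eval (s x.length) := TM2Iter.eval_mono p (hsl x)
        show y₀.length ≤ (2 * K₀ + 2) * 2 ^ (c₀ * x.length) + (2 * K₀ + 2)
        linarith [hy₀, hp, hBx, Nat.zero_le (2 ^ (c₀ * x.length)),
          Nat.zero_le (a * (2 * s x.length + 3 + p.eval (s x.length)) ^ k),
          Nat.zero_le (K * 2 ^ (c * x.length))]
      · rw [hind, List.take_of_length_le (by omega), boolPair_mem_LenLe]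
        exact ⟨hy₀, hmem⟩
    · rintro ⟨y, -, hR⟩
      rw [hind, boolPair_mem_LenLe] at hR
      exact ⟨_, hR.1, hR.2⟩

/-! ### Lemma 2 (deterministic): preimages of `E` languages under logarithmically short `FP` maps -/

/-- **Book 1974, Lemma 2 (deterministic case), functional form.** If `f ∈ FP` has
logarithmically short values (`2^{|f w|} ≤ 2|w| + 2`, as the tally decoder `tallyDecodeFn`:
`two_pow_length_tallyDecodeFn_le`) and `L ∈ E`, then `f ⁻¹' L ∈ P`: compute `f` in polynomial
time (Book: "write `w` on a storage tape where `n(w) = m`"), then run the `K 2^{cn} + K`-time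
decider of `L` on the short word, which takes `≤ K (2|w|+2)^c + K` steps ("the amount of time
needed by `M₂` is of the order `2m + g(|w|)` … `|w| ≤ c₂ log m`").
[cite: Book1974, Lemma 2 (p. 187–188)] -/
theorem preimage_E_mem_P {f : List Bool → List Bool} (hf : f ∈ FP)
    (hlen : ∀ w, 2 ^ (f w).length ≤ 2 * w.length + 2) {L : Language Bool} (hL : L ∈ E) :
    pre f L ∈ Classes.P := by
  simp only [E, Set.mem_iUnion] at hL
  obtain ⟨c, K, hdec⟩ := hL
  obtain ⟨M, hM⟩ := (hdec : TimeDecidable id L fun n => K * 2 ^ (c * n) + K)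
  obtain ⟨p, D, hD⟩ := hf
  refine timeClass_subset_P_of_polynomial_holds
    (Polynomial.C K * (2 * X + 2) ^ c + Polynomial.C K + p) ?_
  refine ⟨D.comp M, fun w => ?_⟩
  have h₁ : D.OutputsWithin w (f w) (p.eval w.length) := hD w
  have h₂ : M.OutputsWithin (f w) (encodeBool (L.boolIndicator (f w)))
      (K * 2 ^ (c * (f w).length) + K) := hM (f w)
  have h := TM2ComputableAux.comp_outputsWithin D M h₁ h₂
  have hind : L.boolIndicator (f w) = (pre f L).boolIndicator w := rfl
  rw [hind] at h
  refine h.mono ?_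
  have hpow : 2 ^ (c * (f w).length) ≤ (2 * w.length + 2) ^ c := by
    rw [mul_comm, pow_mul]
    exact Nat.pow_le_pow_left (hlen w) c
  have hK := Nat.mul_le_mul_left K hpow
  simp only [id, eval_add, eval_mul, eval_C, eval_X, eval_pow, eval_ofNat]
  omega

/-! ### Theorem 1: (i) ⇒ (ii) -/

/-- **Book 1974, Theorem 1, (i) ⇒ (ii).** If `NE ⊆ E` then every tally language `L ∈ NP` is in
`P`. With `L₂ = pad0Fn ⁻¹' L` (the language with `TALLY(L₂) = L` away from the empty word):
`L₂ ∈ NE` (Lemma 3, `preimage_NP_mem_NE`), so `L₂ ∈ E` by (i), so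
`T = pre tallyDecodeFn L₂ ∈ P` (Lemma 2, `preimage_E_mem_P`); and for a nonempty word `w`,
`w ∈ L ↔ w = 0^{|w|} ∧ 0^{|w|} = pad0Fn (tallyDecodeFn w) ∈ L ↔ w ∈ 0* ⊓ T`, so `L` is
`0* ⊓ T ⊓ {ε}ᶜ`, or its union with `{ε}`, both in `P`. [cite: Book1974, Theorem 1 (p. 189), (i) ⇒ (ii)] -/
theorem tally_NP_mem_P_of_NE_subset_E (hNE : NE ⊆ E) {L : Language Bool} (hT : IsTally L)
    (hL : L ∈ NP) : L ∈ Classes.P := by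
  have hL₂ : pre pad0Fn L ∈ E := hNE (preimage_NP_mem_NE pad0Fn_mem_FE hL)
  have hTP : pre tallyDecodeFn (pre pad0Fn L) ∈ Classes.P :=
    preimage_E_mem_P tallyDecodeFn_mem_FP two_pow_length_tallyDecodeFn_le hL₂
  have hcore : zerosFmt ⊓ pre tallyDecodeFn (pre pad0Fn L) ⊓ nilLangᶜ ∈ Classes.P :=
    inter_mem_P (inter_mem_P zerosFmt_mem_P hTP) (compl_mem_P_iff.2 nilLang_mem_P)
  -- the key equivalence on nonempty words
  have key : ∀ w : List Bool, w ≠ [] →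
      (w ∈ L ↔ w ∈ zerosFmt ⊓ pre tallyDecodeFn (pre pad0Fn L) ⊓ nilLangᶜ) := by
    intro w hw
    rw [mem_inf_lang, mem_inf_lang, mem_compl_lang, mem_nilLang, mem_pre, mem_pre,
      pad0Fn_tallyDecodeFn hw]
    constructor
    · intro hwL
      have hrep := eq_replicate_of_isTally hT hwL
      exact ⟨⟨hrep ▸ replicate_false_mem_zerosFmt w.length, hrep ▸ hwL⟩, hw⟩
    · rintro ⟨⟨hz, hmem⟩, -⟩
      have hrep : w = List.replicate w.length false :=
        List.eq_replicate_iff.2 ⟨rfl, (mem_zerosFmt_iff w).1 hz⟩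
      rw [hrep]
      exact hmem
  by_cases h0 : ([] : List Bool) ∈ L
  · have hEq : L = (zerosFmt ⊓ pre tallyDecodeFn (pre pad0Fn L) ⊓ nilLangᶜ) ⊔ nilLang := by
      ext w
      rw [mem_sup_lang, mem_nilLang]
      rcases eq_or_ne w [] with rfl | hw
      · exact ⟨fun _ => Or.inr rfl, fun _ => h0⟩
      · rw [← key w hw]
        exact ⟨Or.inl, fun h => h.resolve_right hw⟩
    rw [hEq]
    exact union_mem_P hcore nilLang_mem_P
  · have hEq : L = zerosFmt ⊓ pre tallyDecodeFn (pre pad0Fn L) ⊓ nilLangᶜ := by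
      ext w
      rcases eq_or_ne w [] with rfl | hw
      · rw [mem_inf_lang, mem_compl_lang, mem_nilLang]
        exact ⟨fun h => absurd h h0, fun h => absurd rfl h.2⟩
      · exact key w hw
    rw [hEq]
    exact hcore

/-! ### Theorem 1: (ii) ⇒ (i) -/

/-- **Book 1974, Theorem 1, (ii) ⇒ (i).** If every tally language in `NP` is in `P` then
`NE ⊆ E`. For `L ∈ NTIME(2^{an})` the tally language `T₀(L) = 0* ⊓ tallyDecodeFn ⁻¹' L =
{0^{tnum x} | x ∈ L}` is in `NP` (Lemma 2, `AvgTallyNE.tallyTruncLang_mem_NP`, meet `0* ∈ P`) and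
is tally, hence in `P` by (ii); and `x ∈ L ↔ 0^{tnum x} = pad0Fn x ∈ T₀(L)`, so
`L = pad0Fn ⁻¹' T₀(L) ∈ E` (Lemma 3, `preimage_mem_E` with `pad0Fn ∈ FE`).
[cite: Book1974, Theorem 1 (p. 189), (ii) ⇒ (i)] -/
theorem NE_subset_E_of_tally_NP_subset_P
    (h : ∀ L : Language Bool, IsTally L → L ∈ NP → L ∈ Classes.P) : NE ⊆ E := by
  intro L hL
  simp only [NE, Set.mem_iUnion] at hL
  obtain ⟨a, ha⟩ := hL
  have hNP : pre tallyDecodeFn L ∈ NP := tallyTruncLang_mem_NP ha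
  have hT₀ : zerosFmt ⊓ pre tallyDecodeFn L ∈ NP :=
    inter_P_mem_polyExists (fun _ _ h₁ h₂ => inter_mem_P h₁ h₂) zerosFmt_mem_P hNP
  have htally : IsTally (zerosFmt ⊓ pre tallyDecodeFn L) := fun w hw => (mem_zerosFmt_iff w).1 hw.1
  have hP : zerosFmt ⊓ pre tallyDecodeFn L ∈ Classes.P := h _ htally hT₀
  have hEq : L = pre pad0Fn (zerosFmt ⊓ pre tallyDecodeFn L) := by
    ext x
    rw [mem_pre, mem_inf_lang, mem_pre, tallyDecodeFn_pad0Fn]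
    exact ⟨fun hx => ⟨pad0Fn_apply x ▸ replicate_false_mem_zerosFmt _, hx⟩, fun h => h.2⟩
  rw [hEq, pre_eq_preimage]
  exact preimage_mem_E pad0Fn_mem_FE hP

end Book1974

/-- **Discharge of `book1974_thm1`** (R. V. Book, *Tally languages and complexity classes*,
Information and Control 26 (1974), Theorem 1, p. 189, (i) ⇔ (ii): "The equivalence of (i) and
(ii) follows from Lemmas 2 and 3"): `NE ⊆ E` iff every tally (`⊆ 0*`) language in `NP` is in
`P` — `Book1974.tally_NP_mem_P_of_NE_subset_E` and `Book1974.NE_subset_E_of_tally_NP_subset_P`.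
[cite: Book1974, Theorem 1 (p. 189), (i) ⇔ (ii); Lemma 2 (p. 187), Lemma 3 (p. 188)] -/
theorem book1974_thm1_holds : book1974_thm1 :=
  ⟨fun hNE _ hT hL => Book1974.tally_NP_mem_P_of_NE_subset_E hNE hT hL,
    Book1974.NE_subset_E_of_tally_NP_subset_P⟩

end Literature.Computability.Complexity

end
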